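import Literature.NumberTheory.Rogawski1990.AdelicStableOrbitalSupportFinite
import Literature.NumberTheory.Rogawski1990.AdelicStableOrbitalIntegral
import Literature.NumberTheory.Automorphic.StableClassMeetingCompact
import Literature.NumberTheory.Automorphic.LocalEndoscopicOrbitClosed
import HarnessLib

/-!
# The `H`-adelic stable class over `γ_H` meets a compact set in finitely many `H(𝐀)`-classes; `Σ_{𝒞′_𝐀(γ_H)} Φ_H(δ, f^H)` is finitely supported
(Rogawski, *Automorphic representations of unitary groups in three variables* (1990), §3.3 p. 21, §4.3 p. 44, §5.4 pp. 72–73 (print); Kottwitz 1986 = [Kt₄], Prop. 7.1)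

Topic `NumberTheory/Rogawski1990`; namespace `Literature.NumberTheory.Rogawski1990`; THEOREMS ONLY (no definition, no instance, no named fact, no `sorry`).
The `H = U(Φ₂) × U(Φ₁)`-side twin of ★ `AdelicStableOrbitalSupportFinite` (`G = U(Φ₃)`), for the carrier ★ `MatchingAdeleH L γH` ∕ ★ `adelicStableClassesOverH L γH`
of the typer brick ★ `AdelicStableOrbitalIntegral` (the index set of `SJ_H`, socket (xiii″) of the floor-0 line `F0_T1InnerFormTraceIdentity`).

What changes on the `H`-side: the second factor `U(Φ₁) = U(1)` is commutative, so «stably conjugate» there is EQUALITY (★ `gl_fin_one_comm`) — the `U(Φ₁)`-component of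
an `H`-matching adèle IS the diagonal `toAdelic (γ_H)₂` (`MatchingAdeleH.adele_snd_eq`); the first factor is `U(Φ₂)`, to which the generic gluing lemma
★ `UnitaryGroup.isConj_of_isConj_archPart_of_forall_exists_conj` (`N = 2`) and ★ p02's compact-set finiteness ★ `finite_image_conjClassesMk_inter_isStablyConj_local`
∕ `…_archCM` apply at the regular `(γ_H)₁` (a `G`-regular `γ_H` has `(γ_H)₁` regular, ★ `IsGRegular.isRegularElt_fst`).  The base point is `γ_H` itself (no
Kottwitz–Steinberg needed: stable conjugacy WITHIN `H`).

* §1 `MatchingAdeleH.adele_snd_eq` (the `U(1)`-coordinate is rigid), `MatchingAdeleH.exists_adele_eq_of_isConj` (the `H`-matching set is saturated under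
  `H(𝐀)`-conjugacy, so `adelicStableClassesOverH` consists of full classes).
* §2 **`MatchingAdeleH.finite_setOf_mem_classes_inter_of_eventually`** — for a compact `C ⊂ H(𝐀)`, given the a.e. `K_v`-conjugacy of [Kt₄] Prop. 7.1 for
  `U(Φ₂)` at the rational regular `(γ_H)₁` as a HYPOTHESIS `hP` (print p. 21: «conjugate by an element of `K_v` for almost all `v`»), only finitely many classes of
  `𝒞′_𝐀(γ_H) = adelicStableClassesOverH L γH` meet `C`.
* §3 **`MatchingAdeleH.finite_classes_inter_support_classOrbitalIntegral_of_eventually`** — hence `(adelicStableClassesOverH L γH ∩ support (classOrbitalIntegral mH fH)).Finite`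
  for EVERY family `mH` of orbital measures on the classes of `H(𝐀)` and EVERY `fH` with compact support: the `finsum` ★ `adelicStableOrbitalIntegralH` is an honest
  finite sum («the sum is finite», §4.3 p. 44) — no Euler hypothesis, no normalisation.  The named-fact wrappers (the `U(Φ_N)`-form of [Kt₄] Prop. 7.1) are left to
  the edition that fixes the fact's home.

## References
* J. D. Rogawski, *Automorphic Representations of Unitary Groups in Three Variables*, Ann. of Math. Stud. 123 (1990), §3.3 p. 21, §4.3 p. 44, §5.4 pp. 72–73
  [Rogawski1990].
* R. E. Kottwitz, *Stable trace formula: elliptic singular terms*, Math. Ann. 275 (1986), Prop. 7.1 [Kottwitz1986].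
* A. Borel, H. Jacquet, *Automorphic forms and automorphic representations*, Proc. Sympos. Pure Math. 33.1 (1979), §4.1 [BorelJacquet1979].
-/
noncomputable section

open NumberField IsDedekindDomain Filter Topology
open scoped MatrixGroups

namespace Literature.NumberTheory.Rogawski1990

open Literature.NumberTheory.Automorphic
open Literature.AlgebraicGeometry.ShimuraVarieties (unitaryGroup)

section FiniteH

variable {L : Type} [Field L] [NumberField L] [IsCMField L]
variable {γH : (UnitaryGroup.cmDatum L 2 (Matrix.of fun i j : Fin 2 => if i.val + j.val + 1 = 2 then (1 : L) else 0)).Rational × (UnitaryGroup.cmDatum L 1 (Matrix.of fun i j : Fin 1 => if i.val + j.val + 1 = 1 then (1 : L) else 0)).Rational}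

/-! ## §1 The `U(1)`-coordinate is rigid; the matching set is saturated -/

/-- In `U(Φ₁)(R) ≤ GL₁(R)` stable conjugacy is EQUALITY (`GL₁` is commutative, ★ `gl_fin_one_comm`). [cite: Rogawski1990, §3.1 p. 19] -/
theorem eq_of_isStablyConj_fin_one {R : Type*} [CommRing R] {σ : R →+* R} {J : Matrix (Fin 1) (Fin 1) R} {x y : unitaryGroup σ J}
    (h : IsStablyConj σ J x y) : x = y := by
  obtain ⟨c, hc⟩ := isStablyConj_iff.1 h
  refine Subtype.ext ?_
  rw [← hc, gl_fin_one_comm c, mul_assoc, mul_inv_cancel, mul_one]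

/-- **The `U(Φ₁)`-component of an `H`-matching adèle over `γ_H = (γ₂, γ₁)` IS the diagonal `toAdelic γ₁`**: it agrees with it at every finite place and
at `∞` (stable conjugacy in `U(1)` is equality, `eq_of_isStablyConj_fin_one`), hence globally (★ `UnitaryGroup.eq_of_archPart_eq_of_forall_toLocal_eq`,
★ `archPart_cmDatum_toAdelic`). [cite: Rogawski1990, §3.3 p. 21] -/
theorem MatchingAdeleH.adele_snd_eq (p : MatchingAdeleH L γH) : p.adele.2 = (UnitaryGroup.cmDatum L 1 (Matrix.of fun i j : Fin 1 => if i.val + j.val + 1 = 1 then (1 : L) else 0)).toAdelic γH.2 := by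
  refine UnitaryGroup.eq_of_archPart_eq_of_forall_toLocal_eq (↥(maximalRealSubfield L)) L (IsCMField.complexConj L) 1 (Matrix.of fun i j : Fin 1 => if i.val + j.val + 1 = 1 then (1 : L) else 0) ?_ fun v => ?_
  · rw [archPart_cmDatum_toAdelic]
    exact (eq_of_isStablyConj_fin_one p.isArchStablyConjH.2).symm
  · exact (eq_of_isStablyConj_fin_one (p.isLocalStablyConjH v).2).symm

/-- **Saturation**: an `H(𝐀)`-conjugate of an `H`-matching adèle is `H`-matching (conjugacy at each place implies stable conjugacy there,
★ `isStablyConjH_of_isConj`). [cite: Rogawski1990, §5.4 p. 72] -/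
theorem MatchingAdeleH.exists_adele_eq_of_isConj (p : MatchingAdeleH L γH)
    {h : (UnitaryGroup.cmDatum L 2 (Matrix.of fun i j : Fin 2 => if i.val + j.val + 1 = 2 then (1 : L) else 0)).Adelic × (UnitaryGroup.cmDatum L 1 (Matrix.of fun i j : Fin 1 => if i.val + j.val + 1 = 1 then (1 : L) else 0)).Adelic} (hc : IsConj p.adele h) :
    ∃ q : MatchingAdeleH L γH, q.adele = h := by
  refine ⟨⟨h, fun v => ?_, ?_⟩, rfl⟩
  · have h1 : IsConj ((UnitaryGroup.cmDatum L 2 (Matrix.of fun i j : Fin 2 => if i.val + j.val + 1 = 2 then (1 : L) else 0)).toLocal v p.adele.1, (UnitaryGroup.cmDatum L 1 (Matrix.of fun i j : Fin 1 => if i.val + j.val + 1 = 1 then (1 : L) else 0)).toLocal v p.adele.2)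
        ((UnitaryGroup.cmDatum L 2 (Matrix.of fun i j : Fin 2 => if i.val + j.val + 1 = 2 then (1 : L) else 0)).toLocal v h.1, (UnitaryGroup.cmDatum L 1 (Matrix.of fun i j : Fin 1 => if i.val + j.val + 1 = 1 then (1 : L) else 0)).toLocal v h.2) :=
      (MonoidHom.prodMap ((UnitaryGroup.cmDatum L 2 (Matrix.of fun i j : Fin 2 => if i.val + j.val + 1 = 2 then (1 : L) else 0)).toLocal v) ((UnitaryGroup.cmDatum L 1 (Matrix.of fun i j : Fin 1 => if i.val + j.val + 1 = 1 then (1 : L) else 0)).toLocal v)).map_isConj hc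
    exact (p.isLocalStablyConjH v).trans (isStablyConjH_of_isConj h1)
  · have h1 : IsConj p.arch
        (UnitaryGroup.archPart (↥(maximalRealSubfield L)) L (IsCMField.complexConj L) 2 (Matrix.of fun i j : Fin 2 => if i.val + j.val + 1 = 2 then (1 : L) else 0) h.1, UnitaryGroup.archPart (↥(maximalRealSubfield L)) L (IsCMField.complexConj L) 1 (Matrix.of fun i j : Fin 1 => if i.val + j.val + 1 = 1 then (1 : L) else 0) h.2) :=
      (MonoidHom.prodMap (UnitaryGroup.archPart (↥(maximalRealSubfield L)) L (IsCMField.complexConj L) 2 (Matrix.of fun i j : Fin 2 => if i.val + j.val + 1 = 2 then (1 : L) else 0)) (UnitaryGroup.archPart (↥(maximalRealSubfield L)) L (IsCMField.complexConj L) 1 (Matrix.of fun i j : Fin 1 => if i.val + j.val + 1 = 1 then (1 : L) else 0))).map_isConj hc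
    exact p.isArchStablyConjH.trans (isStablyConjH_of_isConj h1)

/-- `c ∈ 𝒞′_𝐀(γ_H)` and `mk h = c` ⇒ `h` is `H`-matching. [cite: Rogawski1990, §5.4 p. 72] -/
theorem exists_matchingAdeleH_adele_eq_of_mem
    {c : ConjClasses ((UnitaryGroup.cmDatum L 2 (Matrix.of fun i j : Fin 2 => if i.val + j.val + 1 = 2 then (1 : L) else 0)).Adelic × (UnitaryGroup.cmDatum L 1 (Matrix.of fun i j : Fin 1 => if i.val + j.val + 1 = 1 then (1 : L) else 0)).Adelic)} (hc : c ∈ adelicStableClassesOverH L γH)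
    {h : (UnitaryGroup.cmDatum L 2 (Matrix.of fun i j : Fin 2 => if i.val + j.val + 1 = 2 then (1 : L) else 0)).Adelic × (UnitaryGroup.cmDatum L 1 (Matrix.of fun i j : Fin 1 => if i.val + j.val + 1 = 1 then (1 : L) else 0)).Adelic} (hh : ConjClasses.mk h = c) :
    ∃ q : MatchingAdeleH L γH, q.adele = h := by
  obtain ⟨p, rfl⟩ := hc
  exact p.exists_adele_eq_of_isConj (ConjClasses.mk_eq_mk_iff_isConj.1 hh.symm)

/-! ## §2 Only finitely many classes of `𝒞′_𝐀(γ_H)` meet a compact set -/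

/-- **Only finitely many `H(𝐀)`-classes of the `H`-adelic stable class over `γ_H = (γ₂, γ₁)` meet a compact set** (`γ₂` regular in `GL₂`; given the a.e.
`K_v`-conjugacy of [Kt₄] Prop. 7.1 for `U(Φ₂)` at the rational `γ₂` as the HYPOTHESIS `hP`): for `C ⊂ H(𝐀)` compact, `{c ∈ 𝒞′_𝐀(γ_H) | c ∩ C ≠ ∅}` is finite.
PROOF as on the `G`-side: `pr₁ C` is integral off a finite `S` (★ `UnitaryGroup.exists_finset_forall_toLocal_mem_of_isCompact`); off `S ∪ S_bad` the first component
of a matching adèle in `C` is `K_v`-conjugate to `(γ₂)_v` (`hP`); at the remaining places and at `∞` finitely many `U(Φ₂)`-classes of the regular stable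
class meet the compact image (★ `finite_image_conjClassesMk_inter_isStablyConj_local` ∕ `…_archCM`); the second component is rigid (`adele_snd_eq`); and an
`H(𝐀)`-class is determined by these data (gluing ★ `UnitaryGroup.isConj_of_isConj_archPart_of_forall_exists_conj` on the first factor).
[cite: Rogawski1990, §3.3 p. 21; §4.3 p. 44; §5.4 p. 72] [cite: Kottwitz1986, Prop. 7.1] -/
theorem MatchingAdeleH.finite_setOf_mem_classes_inter_of_eventually
    (hreg : IsRegularElt ((γH.1 : unitaryGroup (cmConjRingHom L) (Matrix.of fun i j : Fin 2 => if i.val + j.val + 1 = 2 then (1 : L) else 0)).val : GL (Fin 2) L))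
    (hP : ∀ᶠ v in cofinite, ∀ g : (UnitaryGroup.cmDatum L 2 (Matrix.of fun i j : Fin 2 => if i.val + j.val + 1 = 2 then (1 : L) else 0)).Local v,
      g ∈ UnitaryGroup.cmLocalIntegralLevel L 2 (Matrix.of fun i j : Fin 2 => if i.val + j.val + 1 = 2 then (1 : L) else 0) v →
        IsStablyConj (UnitaryGroup.conjLocal L (IsCMField.complexConj L) v) ((UnitaryGroup.adelicForm L 2 (Matrix.of fun i j : Fin 2 => if i.val + j.val + 1 = 2 then (1 : L) else 0)).map (UnitaryGroup.adeleToLocal L v))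
            ((UnitaryGroup.cmDatum L 2 (Matrix.of fun i j : Fin 2 => if i.val + j.val + 1 = 2 then (1 : L) else 0)).toLocal v ((UnitaryGroup.cmDatum L 2 (Matrix.of fun i j : Fin 2 => if i.val + j.val + 1 = 2 then (1 : L) else 0)).toAdelic γH.1)) g →
          ∃ k ∈ UnitaryGroup.cmLocalIntegralLevel L 2 (Matrix.of fun i j : Fin 2 => if i.val + j.val + 1 = 2 then (1 : L) else 0) v,
            k * (UnitaryGroup.cmDatum L 2 (Matrix.of fun i j : Fin 2 => if i.val + j.val + 1 = 2 then (1 : L) else 0)).toLocal v ((UnitaryGroup.cmDatum L 2 (Matrix.of fun i j : Fin 2 => if i.val + j.val + 1 = 2 then (1 : L) else 0)).toAdelic γH.1) * k⁻¹ = g)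
    {C : Set ((UnitaryGroup.cmDatum L 2 (Matrix.of fun i j : Fin 2 => if i.val + j.val + 1 = 2 then (1 : L) else 0)).Adelic × (UnitaryGroup.cmDatum L 1 (Matrix.of fun i j : Fin 1 => if i.val + j.val + 1 = 1 then (1 : L) else 0)).Adelic)} (hC : IsCompact C) :
    {c : ConjClasses ((UnitaryGroup.cmDatum L 2 (Matrix.of fun i j : Fin 2 => if i.val + j.val + 1 = 2 then (1 : L) else 0)).Adelic × (UnitaryGroup.cmDatum L 1 (Matrix.of fun i j : Fin 1 => if i.val + j.val + 1 = 1 then (1 : L) else 0)).Adelic) |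
      c ∈ adelicStableClassesOverH L γH ∧ ∃ h ∈ C, ConjClasses.mk h = c}.Finite := by
  classical
  -- regularity of the components of `γ₂`
  have hγv : ∀ v : HeightOneSpectrum (𝓞 ↥(maximalRealSubfield L)),
      IsRegularElt (((UnitaryGroup.cmDatum L 2 (Matrix.of fun i j : Fin 2 => if i.val + j.val + 1 = 2 then (1 : L) else 0)).toLocal v ((UnitaryGroup.cmDatum L 2 (Matrix.of fun i j : Fin 2 => if i.val + j.val + 1 = 2 then (1 : L) else 0)).toAdelic γH.1)).val :
        GL (Fin 2) (UnitaryGroup.LocalRing L v)) := fun v =>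
    (hreg.map (algebraMap L (AdeleRing (𝓞 L) L))).map (UnitaryGroup.adeleToLocal L v)
  have hγi : IsRegularElt ((cmRationalToArch L 2 (Matrix.of fun i j : Fin 2 => if i.val + j.val + 1 = 2 then (1 : L) else 0) γH.1).val : GL (Fin 2) (mixedEmbedding.mixedSpace L)) := hreg.map (mixedEmbedding L)
  -- (1) `pr₁ C` is integral off a finite set `S`
  have hC1 : IsCompact (Prod.fst '' C) := hC.image continuous_fst
  obtain ⟨S, hS⟩ := UnitaryGroup.exists_finset_forall_toLocal_mem_of_isCompact (↥(maximalRealSubfield L)) L (IsCMField.complexConj L) 2 (Matrix.of fun i j : Fin 2 => if i.val + j.val + 1 = 2 then (1 : L) else 0) hC1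
  -- (2) the bad places of the hypothesis
  have hTfin := Filter.eventually_cofinite.1 hP
  set T : Finset (HeightOneSpectrum (𝓞 ↥(maximalRealSubfield L))) := S ∪ hTfin.toFinset with hTdef
  have hTS : ∀ v ∉ T, v ∉ S := fun v hv h => hv (Finset.mem_union_left _ h)
  have hTP : ∀ v ∉ T, ∀ g : (UnitaryGroup.cmDatum L 2 (Matrix.of fun i j : Fin 2 => if i.val + j.val + 1 = 2 then (1 : L) else 0)).Local v,
      g ∈ UnitaryGroup.cmLocalIntegralLevel L 2 (Matrix.of fun i j : Fin 2 => if i.val + j.val + 1 = 2 then (1 : L) else 0) v →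
        IsStablyConj (UnitaryGroup.conjLocal L (IsCMField.complexConj L) v) ((UnitaryGroup.adelicForm L 2 (Matrix.of fun i j : Fin 2 => if i.val + j.val + 1 = 2 then (1 : L) else 0)).map (UnitaryGroup.adeleToLocal L v))
            ((UnitaryGroup.cmDatum L 2 (Matrix.of fun i j : Fin 2 => if i.val + j.val + 1 = 2 then (1 : L) else 0)).toLocal v ((UnitaryGroup.cmDatum L 2 (Matrix.of fun i j : Fin 2 => if i.val + j.val + 1 = 2 then (1 : L) else 0)).toAdelic γH.1)) g →
          ∃ k ∈ UnitaryGroup.cmLocalIntegralLevel L 2 (Matrix.of fun i j : Fin 2 => if i.val + j.val + 1 = 2 then (1 : L) else 0) v,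
            k * (UnitaryGroup.cmDatum L 2 (Matrix.of fun i j : Fin 2 => if i.val + j.val + 1 = 2 then (1 : L) else 0)).toLocal v ((UnitaryGroup.cmDatum L 2 (Matrix.of fun i j : Fin 2 => if i.val + j.val + 1 = 2 then (1 : L) else 0)).toAdelic γH.1) * k⁻¹ = g := by
    intro v hv
    by_contra hnot
    exact hv (Finset.mem_union_right _ (hTfin.mem_toFinset.2 hnot))
  -- (3) representatives IN `C`
  let rep : ConjClasses ((UnitaryGroup.cmDatum L 2 (Matrix.of fun i j : Fin 2 => if i.val + j.val + 1 = 2 then (1 : L) else 0)).Adelic × (UnitaryGroup.cmDatum L 1 (Matrix.of fun i j : Fin 1 => if i.val + j.val + 1 = 1 then (1 : L) else 0)).Adelic) →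
      (UnitaryGroup.cmDatum L 2 (Matrix.of fun i j : Fin 2 => if i.val + j.val + 1 = 2 then (1 : L) else 0)).Adelic × (UnitaryGroup.cmDatum L 1 (Matrix.of fun i j : Fin 1 => if i.val + j.val + 1 = 1 then (1 : L) else 0)).Adelic := fun c =>
    if h : ∃ g ∈ C, ConjClasses.mk g = c then h.choose else Quotient.out c
  have hrep : ∀ c, (∃ g ∈ C, ConjClasses.mk g = c) → rep c ∈ C ∧ ConjClasses.mk (rep c) = c := by
    intro c h
    simp only [rep, dif_pos h]
    exact h.choose_spec
  have hmatch : ∀ c, c ∈ adelicStableClassesOverH L γH → (∃ g ∈ C, ConjClasses.mk g = c) → ∃ p : MatchingAdeleH L γH, p.adele = rep c :=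
    fun c hc h => exists_matchingAdeleH_adele_eq_of_mem hc (hrep c h).2
  -- (4) finitely many `U(Φ₂)`-classes at each place, and at `∞`, meet the image of `pr₁ C`
  have hAv : ∀ v : HeightOneSpectrum (𝓞 ↥(maximalRealSubfield L)),
      (ConjClasses.mk '' {x : (UnitaryGroup.cmDatum L 2 (Matrix.of fun i j : Fin 2 => if i.val + j.val + 1 = 2 then (1 : L) else 0)).Local v |
        x ∈ (UnitaryGroup.cmDatum L 2 (Matrix.of fun i j : Fin 2 => if i.val + j.val + 1 = 2 then (1 : L) else 0)).toLocal v '' (Prod.fst '' C) ∧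
          IsStablyConj (UnitaryGroup.conjLocal L (IsCMField.complexConj L) v) ((UnitaryGroup.adelicForm L 2 (Matrix.of fun i j : Fin 2 => if i.val + j.val + 1 = 2 then (1 : L) else 0)).map (UnitaryGroup.adeleToLocal L v))
            ((UnitaryGroup.cmDatum L 2 (Matrix.of fun i j : Fin 2 => if i.val + j.val + 1 = 2 then (1 : L) else 0)).toLocal v ((UnitaryGroup.cmDatum L 2 (Matrix.of fun i j : Fin 2 => if i.val + j.val + 1 = 2 then (1 : L) else 0)).toAdelic γH.1)) x}).Finite := fun v =>
    UnitaryGroup.finite_image_conjClassesMk_inter_isStablyConj_local L 2 (Matrix.of fun i j : Fin 2 => if i.val + j.val + 1 = 2 then (1 : L) else 0) v (UnitaryGroup.antidiagOne_isHermitian L 2)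
      (UnitaryGroup.isUnit_antidiagOne_det L 2).ne_zero _ (hγv v) (hC1.image ((UnitaryGroup.cmDatum L 2 (Matrix.of fun i j : Fin 2 => if i.val + j.val + 1 = 2 then (1 : L) else 0)).continuous_toLocal v))
  have hAi : (ConjClasses.mk '' {x : UnitaryGroup.arch (↥(maximalRealSubfield L)) L (IsCMField.complexConj L) 2 (Matrix.of fun i j : Fin 2 => if i.val + j.val + 1 = 2 then (1 : L) else 0) |
      x ∈ UnitaryGroup.archPart (↥(maximalRealSubfield L)) L (IsCMField.complexConj L) 2 (Matrix.of fun i j : Fin 2 => if i.val + j.val + 1 = 2 then (1 : L) else 0) '' (Prod.fst '' C) ∧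
        IsStablyConj (UnitaryGroup.conjMixed (↥(maximalRealSubfield L)) L (IsCMField.complexConj L)) (UnitaryGroup.archFormOf L 2 (Matrix.of fun i j : Fin 2 => if i.val + j.val + 1 = 2 then (1 : L) else 0)) (cmRationalToArch L 2 (Matrix.of fun i j : Fin 2 => if i.val + j.val + 1 = 2 then (1 : L) else 0) γH.1) x}).Finite :=
    UnitaryGroup.finite_image_conjClassesMk_inter_isStablyConj_archCM L 2 (Matrix.of fun i j : Fin 2 => if i.val + j.val + 1 = 2 then (1 : L) else 0) (UnitaryGroup.antidiagOne_isHermitian L 2)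
      (UnitaryGroup.isUnit_antidiagOne_det L 2).ne_zero _ hγi (hC1.image (UnitaryGroup.continuous_archPart (↥(maximalRealSubfield L)) L (IsCMField.complexConj L) 2 (Matrix.of fun i j : Fin 2 => if i.val + j.val + 1 = 2 then (1 : L) else 0)))
  -- (5) the map «class ↦ (local classes of the first component at T, its archimedean class)», with finite target on our set
  let Ψ : ConjClasses ((UnitaryGroup.cmDatum L 2 (Matrix.of fun i j : Fin 2 => if i.val + j.val + 1 = 2 then (1 : L) else 0)).Adelic × (UnitaryGroup.cmDatum L 1 (Matrix.of fun i j : Fin 1 => if i.val + j.val + 1 = 1 then (1 : L) else 0)).Adelic) →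
      ((v : ↥T) → ConjClasses ((UnitaryGroup.cmDatum L 2 (Matrix.of fun i j : Fin 2 => if i.val + j.val + 1 = 2 then (1 : L) else 0)).Local v.1)) × ConjClasses (UnitaryGroup.arch (↥(maximalRealSubfield L)) L (IsCMField.complexConj L) 2 (Matrix.of fun i j : Fin 2 => if i.val + j.val + 1 = 2 then (1 : L) else 0)) := fun c =>
    (fun v => ConjClasses.mk ((UnitaryGroup.cmDatum L 2 (Matrix.of fun i j : Fin 2 => if i.val + j.val + 1 = 2 then (1 : L) else 0)).toLocal v.1 (rep c).1),
      ConjClasses.mk (UnitaryGroup.archPart (↥(maximalRealSubfield L)) L (IsCMField.complexConj L) 2 (Matrix.of fun i j : Fin 2 => if i.val + j.val + 1 = 2 then (1 : L) else 0) (rep c).1))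
  have hfinTarget : (Set.pi Set.univ (fun v : ↥T => ConjClasses.mk '' {x : (UnitaryGroup.cmDatum L 2 (Matrix.of fun i j : Fin 2 => if i.val + j.val + 1 = 2 then (1 : L) else 0)).Local v.1 |
        x ∈ (UnitaryGroup.cmDatum L 2 (Matrix.of fun i j : Fin 2 => if i.val + j.val + 1 = 2 then (1 : L) else 0)).toLocal v.1 '' (Prod.fst '' C) ∧
          IsStablyConj (UnitaryGroup.conjLocal L (IsCMField.complexConj L) v.1) ((UnitaryGroup.adelicForm L 2 (Matrix.of fun i j : Fin 2 => if i.val + j.val + 1 = 2 then (1 : L) else 0)).map (UnitaryGroup.adeleToLocal L v.1))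
            ((UnitaryGroup.cmDatum L 2 (Matrix.of fun i j : Fin 2 => if i.val + j.val + 1 = 2 then (1 : L) else 0)).toLocal v.1 ((UnitaryGroup.cmDatum L 2 (Matrix.of fun i j : Fin 2 => if i.val + j.val + 1 = 2 then (1 : L) else 0)).toAdelic γH.1)) x}) ×ˢ
      (ConjClasses.mk '' {x : UnitaryGroup.arch (↥(maximalRealSubfield L)) L (IsCMField.complexConj L) 2 (Matrix.of fun i j : Fin 2 => if i.val + j.val + 1 = 2 then (1 : L) else 0) |
        x ∈ UnitaryGroup.archPart (↥(maximalRealSubfield L)) L (IsCMField.complexConj L) 2 (Matrix.of fun i j : Fin 2 => if i.val + j.val + 1 = 2 then (1 : L) else 0) '' (Prod.fst '' C) ∧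
          IsStablyConj (UnitaryGroup.conjMixed (↥(maximalRealSubfield L)) L (IsCMField.complexConj L)) (UnitaryGroup.archFormOf L 2 (Matrix.of fun i j : Fin 2 => if i.val + j.val + 1 = 2 then (1 : L) else 0)) (cmRationalToArch L 2 (Matrix.of fun i j : Fin 2 => if i.val + j.val + 1 = 2 then (1 : L) else 0) γH.1) x})).Finite :=
    (Set.Finite.pi fun v => hAv v.1).prod hAi
  have hmaps : Set.MapsTo Ψ {c | c ∈ adelicStableClassesOverH L γH ∧ ∃ h ∈ C, ConjClasses.mk h = c}
      (Set.pi Set.univ (fun v : ↥T => ConjClasses.mk '' {x : (UnitaryGroup.cmDatum L 2 (Matrix.of fun i j : Fin 2 => if i.val + j.val + 1 = 2 then (1 : L) else 0)).Local v.1 |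
        x ∈ (UnitaryGroup.cmDatum L 2 (Matrix.of fun i j : Fin 2 => if i.val + j.val + 1 = 2 then (1 : L) else 0)).toLocal v.1 '' (Prod.fst '' C) ∧
          IsStablyConj (UnitaryGroup.conjLocal L (IsCMField.complexConj L) v.1) ((UnitaryGroup.adelicForm L 2 (Matrix.of fun i j : Fin 2 => if i.val + j.val + 1 = 2 then (1 : L) else 0)).map (UnitaryGroup.adeleToLocal L v.1))
            ((UnitaryGroup.cmDatum L 2 (Matrix.of fun i j : Fin 2 => if i.val + j.val + 1 = 2 then (1 : L) else 0)).toLocal v.1 ((UnitaryGroup.cmDatum L 2 (Matrix.of fun i j : Fin 2 => if i.val + j.val + 1 = 2 then (1 : L) else 0)).toAdelic γH.1)) x}) ×ˢ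
      (ConjClasses.mk '' {x : UnitaryGroup.arch (↥(maximalRealSubfield L)) L (IsCMField.complexConj L) 2 (Matrix.of fun i j : Fin 2 => if i.val + j.val + 1 = 2 then (1 : L) else 0) |
        x ∈ UnitaryGroup.archPart (↥(maximalRealSubfield L)) L (IsCMField.complexConj L) 2 (Matrix.of fun i j : Fin 2 => if i.val + j.val + 1 = 2 then (1 : L) else 0) '' (Prod.fst '' C) ∧
          IsStablyConj (UnitaryGroup.conjMixed (↥(maximalRealSubfield L)) L (IsCMField.complexConj L)) (UnitaryGroup.archFormOf L 2 (Matrix.of fun i j : Fin 2 => if i.val + j.val + 1 = 2 then (1 : L) else 0)) (cmRationalToArch L 2 (Matrix.of fun i j : Fin 2 => if i.val + j.val + 1 = 2 then (1 : L) else 0) γH.1) x})) := by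
    rintro c ⟨hc, hgC⟩
    obtain ⟨p, hp⟩ := hmatch c hc hgC
    have hrc := (hrep c hgC).1
    have hrc1 : (rep c).1 ∈ Prod.fst '' C := ⟨rep c, hrc, rfl⟩
    refine Set.mk_mem_prod (Set.mem_univ_pi.2 fun v => ?_) ?_
    · refine ⟨(UnitaryGroup.cmDatum L 2 (Matrix.of fun i j : Fin 2 => if i.val + j.val + 1 = 2 then (1 : L) else 0)).toLocal v.1 (rep c).1, ⟨⟨(rep c).1, hrc1, rfl⟩, ?_⟩, rfl⟩
      have h2 := (p.isLocalStablyConjH v.1).1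
      rw [hp] at h2
      exact h2
    · refine ⟨UnitaryGroup.archPart (↥(maximalRealSubfield L)) L (IsCMField.complexConj L) 2 (Matrix.of fun i j : Fin 2 => if i.val + j.val + 1 = 2 then (1 : L) else 0) (rep c).1, ⟨⟨(rep c).1, hrc1, rfl⟩, ?_⟩, rfl⟩
      have h2 := p.isArchStablyConjH.1
      rw [MatchingAdeleH.arch, hp] at h2
      exact h2
  -- (6) injectivity on our set: second components are rigid, first components glue
  have hinj : Set.InjOn Ψ {c | c ∈ adelicStableClassesOverH L γH ∧ ∃ h ∈ C, ConjClasses.mk h = c} := by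
    rintro c ⟨hc, hgC⟩ c' ⟨hc', hgC'⟩ heq
    obtain ⟨p, hp⟩ := hmatch c hc hgC
    obtain ⟨p', hp'⟩ := hmatch c' hc' hgC'
    have hrc := hrep c hgC
    have hrc' := hrep c' hgC'
    have hrc1 : (rep c).1 ∈ Prod.fst '' C := ⟨rep c, hrc.1, rfl⟩
    have hrc1' : (rep c').1 ∈ Prod.fst '' C := ⟨rep c', hrc'.1, rfl⟩
    -- second components are equal
    have hsnd : (rep c).2 = (rep c').2 := by
      rw [← hp, ← hp', p.adele_snd_eq, p'.adele_snd_eq]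
    -- at the good places both first components are `K_v`-conjugate to `(γ₂)_v`
    have hgood : ∀ v ∉ T, ∃ k ∈ UnitaryGroup.cmLocalIntegralLevel L 2 (Matrix.of fun i j : Fin 2 => if i.val + j.val + 1 = 2 then (1 : L) else 0) v,
        k * (UnitaryGroup.cmDatum L 2 (Matrix.of fun i j : Fin 2 => if i.val + j.val + 1 = 2 then (1 : L) else 0)).toLocal v (rep c).1 * k⁻¹ = (UnitaryGroup.cmDatum L 2 (Matrix.of fun i j : Fin 2 => if i.val + j.val + 1 = 2 then (1 : L) else 0)).toLocal v (rep c').1 := by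
      intro v hv
      have h1 := (p.isLocalStablyConjH v).1
      rw [hp] at h1
      have h1' := (p'.isLocalStablyConjH v).1
      rw [hp'] at h1'
      obtain ⟨k, hk, hkeq⟩ := hTP v hv ((UnitaryGroup.cmDatum L 2 (Matrix.of fun i j : Fin 2 => if i.val + j.val + 1 = 2 then (1 : L) else 0)).toLocal v (rep c).1) (hS _ hrc1 v (hTS v hv)) h1
      obtain ⟨k', hk', hkeq'⟩ := hTP v hv ((UnitaryGroup.cmDatum L 2 (Matrix.of fun i j : Fin 2 => if i.val + j.val + 1 = 2 then (1 : L) else 0)).toLocal v (rep c').1) (hS _ hrc1' v (hTS v hv)) h1'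
      refine ⟨k' * k⁻¹, mul_mem hk' (inv_mem hk), ?_⟩
      rw [← hkeq, ← hkeq', mul_inv_rev, inv_inv]
      group
    have hconj1 : IsConj (rep c).1 (rep c').1 := by
      refine UnitaryGroup.isConj_of_isConj_archPart_of_forall_exists_conj (↥(maximalRealSubfield L)) L (IsCMField.complexConj L) 2 (Matrix.of fun i j : Fin 2 => if i.val + j.val + 1 = 2 then (1 : L) else 0) ?_ (fun v => ?_) ?_
      · exact ConjClasses.mk_eq_mk_iff_isConj.1 (congrArg Prod.snd heq)
      · by_cases hvT : v ∈ T
        · exact ConjClasses.mk_eq_mk_iff_isConj.1 (congrFun (congrArg Prod.fst heq) ⟨v, hvT⟩)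
        · obtain ⟨k, -, hk⟩ := hgood v hvT
          exact isConj_iff.2 ⟨k, hk⟩
      · filter_upwards [T.finite_toSet.compl_mem_cofinite] with v hv
        obtain ⟨k, hk, hkeq⟩ := hgood v hv
        exact ⟨k, hk, hkeq⟩
    have hconj : IsConj (rep c) (rep c') := by
      obtain ⟨x, hx⟩ := isConj_iff.1 hconj1
      refine isConj_iff.2 ⟨(x, 1), ?_⟩
      refine Prod.ext ?_ ?_
      · simpa only [Prod.fst_mul, Prod.fst_inv] using hx
      · simp only [Prod.snd_mul, Prod.snd_inv, one_mul, inv_one, mul_one, hsnd]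
    rw [← hrc.2, ← hrc'.2]
    exact ConjClasses.mk_eq_mk_iff_isConj.2 hconj
  exact Set.Finite.of_finite_image (hfinTarget.subset hmaps.image_subset) hinj

/-- The same with the `G`-regularity hypothesis of the line (★ `IsGRegular`: `ι(γ_H)` regular in `GL₃`, which forces `(γ_H)₁` regular in `GL₂`,
★ `IsGRegular.isRegularElt_fst`). [cite: Rogawski1990, §4.3 p. 42; §5.4 p. 72] -/
theorem MatchingAdeleH.finite_setOf_mem_classes_inter_of_isGRegular_of_eventually
    (hreg : IsGRegular (cmConjRingHom L) (Matrix.of fun i j : Fin 2 => if i.val + j.val + 1 = 2 then (1 : L) else 0) (Matrix.of fun i j : Fin 1 => if i.val + j.val + 1 = 1 then (1 : L) else 0) (Matrix.of fun i j : Fin 3 => if i.val + j.val + 1 = 3 then (1 : L) else 0)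
      endoForm_antidiagOne γH)
    (hP : ∀ᶠ v in cofinite, ∀ g : (UnitaryGroup.cmDatum L 2 (Matrix.of fun i j : Fin 2 => if i.val + j.val + 1 = 2 then (1 : L) else 0)).Local v,
      g ∈ UnitaryGroup.cmLocalIntegralLevel L 2 (Matrix.of fun i j : Fin 2 => if i.val + j.val + 1 = 2 then (1 : L) else 0) v →
        IsStablyConj (UnitaryGroup.conjLocal L (IsCMField.complexConj L) v) ((UnitaryGroup.adelicForm L 2 (Matrix.of fun i j : Fin 2 => if i.val + j.val + 1 = 2 then (1 : L) else 0)).map (UnitaryGroup.adeleToLocal L v))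
            ((UnitaryGroup.cmDatum L 2 (Matrix.of fun i j : Fin 2 => if i.val + j.val + 1 = 2 then (1 : L) else 0)).toLocal v ((UnitaryGroup.cmDatum L 2 (Matrix.of fun i j : Fin 2 => if i.val + j.val + 1 = 2 then (1 : L) else 0)).toAdelic γH.1)) g →
          ∃ k ∈ UnitaryGroup.cmLocalIntegralLevel L 2 (Matrix.of fun i j : Fin 2 => if i.val + j.val + 1 = 2 then (1 : L) else 0) v,
            k * (UnitaryGroup.cmDatum L 2 (Matrix.of fun i j : Fin 2 => if i.val + j.val + 1 = 2 then (1 : L) else 0)).toLocal v ((UnitaryGroup.cmDatum L 2 (Matrix.of fun i j : Fin 2 => if i.val + j.val + 1 = 2 then (1 : L) else 0)).toAdelic γH.1) * k⁻¹ = g)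
    {C : Set ((UnitaryGroup.cmDatum L 2 (Matrix.of fun i j : Fin 2 => if i.val + j.val + 1 = 2 then (1 : L) else 0)).Adelic × (UnitaryGroup.cmDatum L 1 (Matrix.of fun i j : Fin 1 => if i.val + j.val + 1 = 1 then (1 : L) else 0)).Adelic)} (hC : IsCompact C) :
    {c : ConjClasses ((UnitaryGroup.cmDatum L 2 (Matrix.of fun i j : Fin 2 => if i.val + j.val + 1 = 2 then (1 : L) else 0)).Adelic × (UnitaryGroup.cmDatum L 1 (Matrix.of fun i j : Fin 1 => if i.val + j.val + 1 = 1 then (1 : L) else 0)).Adelic) |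
      c ∈ adelicStableClassesOverH L γH ∧ ∃ h ∈ C, ConjClasses.mk h = c}.Finite :=
  MatchingAdeleH.finite_setOf_mem_classes_inter_of_eventually hreg.isRegularElt_fst hP hC

/-! ## §3 `Σ_{δ ∈ 𝒞′_𝐀(γ_H)} Φ_H(δ, f^H)` is a finite sum for every `f^H ∈ C_c(H(𝐀))` and every family of orbital measures -/

/-- **The `H`-adelic stable orbital sum is finitely supported** — for EVERY family `mH` of orbital measures on the classes of `H(𝐀) = U(Φ₂)(𝔸) × U(Φ₁)(𝔸)` and
EVERY `fH` with compact support (`(γ_H)₁` regular, the a.e. `K_v`-conjugacy of [Kt₄] Prop. 7.1 for `U(Φ₂)` at `(γ_H)₁` as a hypothesis):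
`(adelicStableClassesOverH L γH ∩ support (classOrbitalIntegral mH fH)).Finite` — a class with `Φ ≠ 0` meets `tsupport fH`
(★ `orbitalIntegral_eq_zero_of_forall_notMem_tsupport`), and only finitely many classes of `𝒞′_𝐀(γ_H)` do.  So the `finsum` ★ `adelicStableOrbitalIntegralH`
is an honest finite sum. [cite: Rogawski1990, §4.3 p. 44; §5.4 p. 72] [cite: Kottwitz1986, Prop. 7.1] -/
theorem MatchingAdeleH.finite_classes_inter_support_classOrbitalIntegral_of_eventually
    (hreg : IsRegularElt ((γH.1 : unitaryGroup (cmConjRingHom L) (Matrix.of fun i j : Fin 2 => if i.val + j.val + 1 = 2 then (1 : L) else 0)).val : GL (Fin 2) L))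
    (hP : ∀ᶠ v in cofinite, ∀ g : (UnitaryGroup.cmDatum L 2 (Matrix.of fun i j : Fin 2 => if i.val + j.val + 1 = 2 then (1 : L) else 0)).Local v,
      g ∈ UnitaryGroup.cmLocalIntegralLevel L 2 (Matrix.of fun i j : Fin 2 => if i.val + j.val + 1 = 2 then (1 : L) else 0) v →
        IsStablyConj (UnitaryGroup.conjLocal L (IsCMField.complexConj L) v) ((UnitaryGroup.adelicForm L 2 (Matrix.of fun i j : Fin 2 => if i.val + j.val + 1 = 2 then (1 : L) else 0)).map (UnitaryGroup.adeleToLocal L v))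
            ((UnitaryGroup.cmDatum L 2 (Matrix.of fun i j : Fin 2 => if i.val + j.val + 1 = 2 then (1 : L) else 0)).toLocal v ((UnitaryGroup.cmDatum L 2 (Matrix.of fun i j : Fin 2 => if i.val + j.val + 1 = 2 then (1 : L) else 0)).toAdelic γH.1)) g →
          ∃ k ∈ UnitaryGroup.cmLocalIntegralLevel L 2 (Matrix.of fun i j : Fin 2 => if i.val + j.val + 1 = 2 then (1 : L) else 0) v,
            k * (UnitaryGroup.cmDatum L 2 (Matrix.of fun i j : Fin 2 => if i.val + j.val + 1 = 2 then (1 : L) else 0)).toLocal v ((UnitaryGroup.cmDatum L 2 (Matrix.of fun i j : Fin 2 => if i.val + j.val + 1 = 2 then (1 : L) else 0)).toAdelic γH.1) * k⁻¹ = g)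
    [∀ g : (UnitaryGroup.cmDatum L 2 (Matrix.of fun i j : Fin 2 => if i.val + j.val + 1 = 2 then (1 : L) else 0)).Adelic × (UnitaryGroup.cmDatum L 1 (Matrix.of fun i j : Fin 1 => if i.val + j.val + 1 = 1 then (1 : L) else 0)).Adelic,
      MeasurableSpace (((UnitaryGroup.cmDatum L 2 (Matrix.of fun i j : Fin 2 => if i.val + j.val + 1 = 2 then (1 : L) else 0)).Adelic × (UnitaryGroup.cmDatum L 1 (Matrix.of fun i j : Fin 1 => if i.val + j.val + 1 = 1 then (1 : L) else 0)).Adelic) ⧸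
        Subgroup.centralizer ({g} : Set ((UnitaryGroup.cmDatum L 2 (Matrix.of fun i j : Fin 2 => if i.val + j.val + 1 = 2 then (1 : L) else 0)).Adelic × (UnitaryGroup.cmDatum L 1 (Matrix.of fun i j : Fin 1 => if i.val + j.val + 1 = 1 then (1 : L) else 0)).Adelic)))]
    (mH : OrbitalMeasureFamily ((UnitaryGroup.cmDatum L 2 (Matrix.of fun i j : Fin 2 => if i.val + j.val + 1 = 2 then (1 : L) else 0)).Adelic × (UnitaryGroup.cmDatum L 1 (Matrix.of fun i j : Fin 1 => if i.val + j.val + 1 = 1 then (1 : L) else 0)).Adelic))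
    {E : Type*} [NormedAddCommGroup E] [NormedSpace ℝ E]
    {fH : (UnitaryGroup.cmDatum L 2 (Matrix.of fun i j : Fin 2 => if i.val + j.val + 1 = 2 then (1 : L) else 0)).Adelic × (UnitaryGroup.cmDatum L 1 (Matrix.of fun i j : Fin 1 => if i.val + j.val + 1 = 1 then (1 : L) else 0)).Adelic → E} (hf : HasCompactSupport fH) :
    (adelicStableClassesOverH L γH ∩ Function.support (classOrbitalIntegral mH fH)).Finite := by
  refine (MatchingAdeleH.finite_setOf_mem_classes_inter_of_eventually hreg hP hf.isCompact).subset ?_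
  rintro c ⟨hc, hne⟩
  refine ⟨hc, ?_⟩
  by_contra hno
  refine hne ?_
  rw [classOrbitalIntegral_eq]
  refine orbitalIntegral_eq_zero_of_forall_notMem_tsupport _ _ fun g hg => hno ⟨g * Quotient.out c * g⁻¹, hg, ?_⟩
  rw [← ConjClasses.mk_eq_mk_iff_isConj.2 (isConj_iff.2 ⟨g, rfl⟩), ← ConjClasses.quotient_mk_eq_mk, Quotient.out_eq]

/-- The same under the line's `G`-regularity hypothesis ★ `IsGRegular` and for `fH ∈ C_c(H(𝐀), E)`. [cite: Rogawski1990, §4.3 p. 44; §5.4 p. 72] -/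
theorem MatchingAdeleH.finite_classes_inter_support_classOrbitalIntegral_of_isGRegular_of_eventually
    (hreg : IsGRegular (cmConjRingHom L) (Matrix.of fun i j : Fin 2 => if i.val + j.val + 1 = 2 then (1 : L) else 0) (Matrix.of fun i j : Fin 1 => if i.val + j.val + 1 = 1 then (1 : L) else 0) (Matrix.of fun i j : Fin 3 => if i.val + j.val + 1 = 3 then (1 : L) else 0)
      endoForm_antidiagOne γH)
    (hP : ∀ᶠ v in cofinite, ∀ g : (UnitaryGroup.cmDatum L 2 (Matrix.of fun i j : Fin 2 => if i.val + j.val + 1 = 2 then (1 : L) else 0)).Local v,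
      g ∈ UnitaryGroup.cmLocalIntegralLevel L 2 (Matrix.of fun i j : Fin 2 => if i.val + j.val + 1 = 2 then (1 : L) else 0) v →
        IsStablyConj (UnitaryGroup.conjLocal L (IsCMField.complexConj L) v) ((UnitaryGroup.adelicForm L 2 (Matrix.of fun i j : Fin 2 => if i.val + j.val + 1 = 2 then (1 : L) else 0)).map (UnitaryGroup.adeleToLocal L v))
            ((UnitaryGroup.cmDatum L 2 (Matrix.of fun i j : Fin 2 => if i.val + j.val + 1 = 2 then (1 : L) else 0)).toLocal v ((UnitaryGroup.cmDatum L 2 (Matrix.of fun i j : Fin 2 => if i.val + j.val + 1 = 2 then (1 : L) else 0)).toAdelic γH.1)) g →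
          ∃ k ∈ UnitaryGroup.cmLocalIntegralLevel L 2 (Matrix.of fun i j : Fin 2 => if i.val + j.val + 1 = 2 then (1 : L) else 0) v,
            k * (UnitaryGroup.cmDatum L 2 (Matrix.of fun i j : Fin 2 => if i.val + j.val + 1 = 2 then (1 : L) else 0)).toLocal v ((UnitaryGroup.cmDatum L 2 (Matrix.of fun i j : Fin 2 => if i.val + j.val + 1 = 2 then (1 : L) else 0)).toAdelic γH.1) * k⁻¹ = g)
    [∀ g : (UnitaryGroup.cmDatum L 2 (Matrix.of fun i j : Fin 2 => if i.val + j.val + 1 = 2 then (1 : L) else 0)).Adelic × (UnitaryGroup.cmDatum L 1 (Matrix.of fun i j : Fin 1 => if i.val + j.val + 1 = 1 then (1 : L) else 0)).Adelic,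
      MeasurableSpace (((UnitaryGroup.cmDatum L 2 (Matrix.of fun i j : Fin 2 => if i.val + j.val + 1 = 2 then (1 : L) else 0)).Adelic × (UnitaryGroup.cmDatum L 1 (Matrix.of fun i j : Fin 1 => if i.val + j.val + 1 = 1 then (1 : L) else 0)).Adelic) ⧸
        Subgroup.centralizer ({g} : Set ((UnitaryGroup.cmDatum L 2 (Matrix.of fun i j : Fin 2 => if i.val + j.val + 1 = 2 then (1 : L) else 0)).Adelic × (UnitaryGroup.cmDatum L 1 (Matrix.of fun i j : Fin 1 => if i.val + j.val + 1 = 1 then (1 : L) else 0)).Adelic)))]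
    (mH : OrbitalMeasureFamily ((UnitaryGroup.cmDatum L 2 (Matrix.of fun i j : Fin 2 => if i.val + j.val + 1 = 2 then (1 : L) else 0)).Adelic × (UnitaryGroup.cmDatum L 1 (Matrix.of fun i j : Fin 1 => if i.val + j.val + 1 = 1 then (1 : L) else 0)).Adelic))
    {E : Type*} [NormedAddCommGroup E] [NormedSpace ℝ E]
    (fH : CompactlySupportedContinuousMap ((UnitaryGroup.cmDatum L 2 (Matrix.of fun i j : Fin 2 => if i.val + j.val + 1 = 2 then (1 : L) else 0)).Adelic × (UnitaryGroup.cmDatum L 1 (Matrix.of fun i j : Fin 1 => if i.val + j.val + 1 = 1 then (1 : L) else 0)).Adelic) E) :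
    (adelicStableClassesOverH L γH ∩ Function.support (classOrbitalIntegral mH fH)).Finite :=
  MatchingAdeleH.finite_classes_inter_support_classOrbitalIntegral_of_eventually hreg.isRegularElt_fst hP mH fH.hasCompactSupport

end FiniteH

end Literature.NumberTheory.Rogawski1990
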